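import Mathlib
import HarnessLib
import Summits.Ventures.LatticeQCDFlow.Exactness.LatticeCoordAvg
import Summits.Ventures.LatticeQCDFlow.Scaling.AutoregressiveMarkovContext

/-!
# LatticeQCDFlow / Scaling — a genuine bond IS read: the exact autoregressive conditional of `a`
# reads a retained coordinate `j` coupled to `a` by a non-product factor (the first LOWER-bound /
# faithfulness statement; C5's "first non-trivial test", the nearest-neighbour chain, typed)

HONEST FRAMING: exact (Metropolis-corrected) sampling algorithms for lattice gauge theory;
figures of merit are autocorrelation/cost numbers at stated couplings and volumes; no
continuum-physics claim.

Venture `LatticeQCDFlow` (cell pub-lqcd), topic `Scaling`, FANOUT row 30 (lean-1, GEN-16) — OUR WORK on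
THEORY-2.md §4 conjecture C5 (faithfulness: "the exact KR map has EXACTLY the symbolic sparsity";
"first non-trivial test: 1-d `φ⁴` chain — is `∂_{k−1}S^k ≢ 0`? (yes unless the coupling vanishes —
immediate from the conditional density)").  All of GEN-14/15/16 so far bounds the context from
ABOVE.  This file proves the first bound from BELOW, in the coordinate-average form of the tree
(`A_s w = Exactness.coordAvg μ s w`, the exact conditional `A_s w / A_{insert a s} w` of `a` given the
retained coordinates), for ANY index set, measurable space and reference probability measure:

* §1 **`bond_productForm_of_arConditional_blind`** — let `w = f₀ · w₁ · w₂` with `f₀(φ) = F(φ_a, φ_j)`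
  a two-body factor between the current variable `a` and a RETAINED variable `j` (`a, j ∉ s`,
  `j ≠ a`), `w₁` blind to `j`, `w₂` blind to `a` and to every integrated coordinate (the other terms
  sort into these two for a nearest-neighbour chain), everything non-vanishing.  IF the exact
  conditional of `a` does NOT read `j` (same value on configurations agreeing off `j`), THEN `F` is of
  PRODUCT FORM on the values involved: `F u t · F u' t' = F u t' · F u' t`.  Proof: `f₀` and `w₂` come
  out of `A_s` (`coordAvg_mul_left`), `A_s w₁` is blind to `j`, `A_{insert a s} w` is blind to `a`;
  compare the double ratio `R(u,t) R(u',t') / (R(u,t') R(u',t))`.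
* §2 Contrapositive **`arConditional_reads_bond`** — a factor that is NOT of product form
  (`F u t · F u' t' ≠ F u t' · F u' t` for some values) forces the conditional of `a` to READ `j`:
  there are two configurations agreeing off `j` with different conditionals.  Instance
  **`gaussianBond_not_productForm`**: `F u t = exp(−κ(u−t)²/2)` with `κ ≠ 0` is not of product form
  (`u ≠ u'`, `t ≠ t'`; the double ratio is `exp(κ(u−u')(t−t'))`) — so in the `φ⁴` / Gaussian chain
  written in gradient form the conditional of a site reads its retained neighbour iff `κ ≠ 0`
  (the "iff": `κ = 0` is the upper bound of `Scaling/AutoregressiveMarkovContext` with no bond).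

READING (value-free, C5): the symbolic context is ATTAINED along every genuine (non-product) two-body
bond from the current variable to a retained one that no other lower term reads — for scalar chains
this is the whole frontier, so the 1-d test of C5 holds as a theorem; in `d ≥ 2` the frontier
variables reached only THROUGH the integrated block are not covered by this argument (C5 proper
stays open there).  NOT CLAIMED: faithfulness through integrated paths; anything for gauge links
(where GEN-15/16 prove the symbolic bound is NOT attained); any number of ours.  Elementary over the
parents; no definition is introduced; nothing is cited as a fact; no `sorry`.
-/

noncomputable section

namespace Summit.Ventures.LatticeQCDFlow.Theory2.Autoregressive

open MeasureTheory Function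
open Summit.Ventures.LatticeQCDFlow.Exactness

variable {ι : Type*} [Fintype ι] [DecidableEq ι]
variable {X : Type*} [MeasurableSpace X]
variable (μ : Measure X)

/-! ## §1 If the conditional is blind to `j`, the bond factor is of product form -/

/-- **IF THE EXACT CONDITIONAL OF `a` DOES NOT READ THE RETAINED VARIABLE `j`, THE TWO-BODY FACTOR
BETWEEN THEM IS OF PRODUCT FORM.**  `w = f₀ · w₁ · w₂`, `f₀ φ = F (φ a) (φ j)` with `a, j ∉ s`,
`j ≠ a`; `w₁` depends only on `V₁ ∌ j`; `w₂` depends only on `V₂` with `a ∉ V₂` and `V₂ ∩ s = ∅`; the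
values of `w₂`, `A_s w₁`, `A_{insert a s} w` involved are non-zero.  If the conditional
`A_s w / A_{insert a s} w` takes the same value on any two configurations agreeing off `j`, then
`F u t · F u' t' = F u t' · F u' t`. [ours] -/
theorem bond_productForm_of_arConditional_blind (s : Finset ι) {a j : ι} (has : a ∉ s)
    (hjs : j ∉ s) (hja : j ≠ a) (F : X → X → ℝ) {w₁ w₂ : (ι → X) → ℝ} {V₁ V₂ : Set ι}
    (hw₁ : DependsOn w₁ V₁) (hjV₁ : j ∉ V₁) (hw₂ : DependsOn w₂ V₂) (haV₂ : a ∉ V₂)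
    (hsV₂ : ∀ i ∈ s, i ∉ V₂) (φ : ι → X) (u u' t t' : X)
    (hw₂ne : ∀ ψ, w₂ ψ ≠ 0) (hG : ∀ ψ, coordAvg μ s w₁ ψ ≠ 0)
    (hM : ∀ ψ, coordAvg μ (insert a s) (fun η => F (η a) (η j) * w₁ η * w₂ η) ψ ≠ 0)
    (hblind : ∀ ψ ψ' : ι → X, (∀ i, i ≠ j → ψ i = ψ' i) →
      coordAvg μ s (fun η => F (η a) (η j) * w₁ η * w₂ η) ψ /
          coordAvg μ (insert a s) (fun η => F (η a) (η j) * w₁ η * w₂ η) ψ =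
        coordAvg μ s (fun η => F (η a) (η j) * w₁ η * w₂ η) ψ' /
          coordAvg μ (insert a s) (fun η => F (η a) (η j) * w₁ η * w₂ η) ψ') :
    F u t * F u' t' = F u t' * F u' t := by
  classical
  -- the four test configurations `φ[a ↦ v][j ↦ r]`
  let c : X → X → (ι → X) := fun v r => update (update φ a v) j r
  have hca : ∀ v r, c v r a = v := fun v r => by
    simp [c, update_of_ne hja.symm]
  have hcj : ∀ v r, c v r j = r := fun v r => by simp [c]
  -- numerator: `f₀` and `w₂` come out of `A_s`, since they do not read `s`
  have hnum : ∀ v r, coordAvg μ s (fun η => F (η a) (η j) * w₁ η * w₂ η) (c v r) =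
      F v r * w₂ (c v r) * coordAvg μ s w₁ (c v r) := by
    intro v r
    have h1 : (fun η : ι → X => F (η a) (η j) * w₁ η * w₂ η) =
        fun η => (F (η a) (η j) * w₂ η) * w₁ η := by
      funext η; ring
    rw [h1, coordAvg_mul_left μ s (Φ := fun η => F (η a) (η j) * w₂ η) (H := w₁) ?_ (c v r), hca, hcj]
    intro ω ω'
    have hwa : (s.piecewise ω' ω) a = ω a := Finset.piecewise_eq_of_notMem _ _ _ has
    have hwj : (s.piecewise ω' ω) j = ω j := Finset.piecewise_eq_of_notMem _ _ _ hjs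
    rw [hwa, hwj, hw₂ (fun i hi => Finset.piecewise_eq_of_notMem _ _ _ (fun his => hsV₂ i his hi))]
  -- `A_s w₁` does not read `j`; `w₂` does not read `a`; the denominator does not read `a`
  have hGj : ∀ v r r', coordAvg μ s w₁ (c v r) = coordAvg μ s w₁ (c v r') := by
    intro v r r'
    refine coordAvg_congr_of_dependsOn μ s hw₁ fun i hi _ => ?_
    have hij : i ≠ j := fun h => hjV₁ (h ▸ hi)
    simp [c, update_of_ne hij]
  have hHa : ∀ v v' r, w₂ (c v r) = w₂ (c v' r) := by
    intro v v' r
    refine hw₂ fun i hi => ?_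
    have hia : i ≠ a := fun h => haV₂ (h ▸ hi)
    by_cases hij : i = j
    · subst hij; simp [c]
    · simp [c, update_of_ne hij, update_of_ne hia]
  have hMa : ∀ v v' r, coordAvg μ (insert a s) (fun η => F (η a) (η j) * w₁ η * w₂ η) (c v r) =
      coordAvg μ (insert a s) (fun η => F (η a) (η j) * w₁ η * w₂ η) (c v' r) := by
    intro v v' r
    refine coordAvg_congr_of_dependsOn μ (insert a s) (V := Set.univ)
      (fun x y h => by rw [show x = y from funext fun i => h i (Set.mem_univ i)]) fun i _ hi => ?_
    have hia : i ≠ a := fun h => hi (h ▸ Finset.mem_insert_self a s)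
    by_cases hij : i = j
    · subst hij; simp [c]
    · simp [c, update_of_ne hij, update_of_ne hia]
  -- the blindness hypothesis on the pairs `(c v t, c v t')`
  have hbl : ∀ v, coordAvg μ s (fun η => F (η a) (η j) * w₁ η * w₂ η) (c v t) /
      coordAvg μ (insert a s) (fun η => F (η a) (η j) * w₁ η * w₂ η) (c v t) =
      coordAvg μ s (fun η => F (η a) (η j) * w₁ η * w₂ η) (c v t') /
      coordAvg μ (insert a s) (fun η => F (η a) (η j) * w₁ η * w₂ η) (c v t') := by
    intro v
    refine hblind _ _ fun i hij => ?_
    simp [c, update_of_ne hij]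
  have e1 := hbl u
  have e2 := hbl u'
  rw [hnum, hnum] at e1 e2
  -- abbreviations
  set G := coordAvg μ s w₁ (c u t) with hGdef
  set G' := coordAvg μ s w₁ (c u' t) with hG'def
  set H := w₂ (c u t) with hHdef
  set H' := w₂ (c u t') with hH'def
  set M := coordAvg μ (insert a s) (fun η => F (η a) (η j) * w₁ η * w₂ η) (c u t) with hMdef
  set M' := coordAvg μ (insert a s) (fun η => F (η a) (η j) * w₁ η * w₂ η) (c u t') with hM'def
  rw [← hGj u t t', ← hGdef] at e1
  rw [hHa u' u t, ← hHdef, hHa u' u t', ← hH'def, ← hGj u' t t', ← hG'def, hMa u' u t, ← hMdef,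
    hMa u' u t', ← hM'def] at e2
  -- e1 : F u t * H * G / M = F u t' * H' * G / M' ;  e2 : F u' t * H * G' / M = F u' t' * H' * G' / M'
  have hGne : G ≠ 0 := hG _
  have hG'ne : G' ≠ 0 := hG _
  have hHne : H ≠ 0 := hw₂ne _
  have hMne : M ≠ 0 := hM _
  have hM'ne : M' ≠ 0 := hM _
  rw [div_eq_div_iff hMne hM'ne] at e1 e2
  have e1' : F u t * (H * M') = F u t' * (H' * M) :=
    mul_right_cancel₀ hGne (by linear_combination e1)
  have e2' : F u' t * (H * M') = F u' t' * (H' * M) :=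
    mul_right_cancel₀ hG'ne (by linear_combination e2)
  have hα : H * M' ≠ 0 := mul_ne_zero hHne hM'ne
  exact mul_right_cancel₀ hα (by linear_combination (F u' t') * e1' - (F u t') * e2')

/-! ## §2 A non-product bond is read; the Gaussian / gradient-`φ⁴` chain bond -/

/-- **A GENUINE (NON-PRODUCT) TWO-BODY FACTOR BETWEEN `a` AND A RETAINED VARIABLE `j` IS READ BY THE
EXACT CONDITIONAL OF `a`** (contrapositive of `bond_productForm_of_arConditional_blind`): if
`F u t · F u' t' ≠ F u t' · F u' t` for some values, there are two configurations agreeing off `j` on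
which the conditional `A_s w / A_{insert a s} w` differs — the LOWER bound matching the frontier
bound of `Scaling/AutoregressiveMarkovContext` along that bond. [ours] -/
theorem arConditional_reads_bond (s : Finset ι) {a j : ι} (has : a ∉ s) (hjs : j ∉ s) (hja : j ≠ a)
    (F : X → X → ℝ) {w₁ w₂ : (ι → X) → ℝ} {V₁ V₂ : Set ι}
    (hw₁ : DependsOn w₁ V₁) (hjV₁ : j ∉ V₁) (hw₂ : DependsOn w₂ V₂) (haV₂ : a ∉ V₂)
    (hsV₂ : ∀ i ∈ s, i ∉ V₂) (hw₂ne : ∀ ψ, w₂ ψ ≠ 0) (hG : ∀ ψ, coordAvg μ s w₁ ψ ≠ 0)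
    (hM : ∀ ψ, coordAvg μ (insert a s) (fun η => F (η a) (η j) * w₁ η * w₂ η) ψ ≠ 0)
    [Nonempty (ι → X)] {u u' t t' : X} (hF : F u t * F u' t' ≠ F u t' * F u' t) :
    ∃ ψ ψ' : ι → X, (∀ i, i ≠ j → ψ i = ψ' i) ∧
      coordAvg μ s (fun η => F (η a) (η j) * w₁ η * w₂ η) ψ /
          coordAvg μ (insert a s) (fun η => F (η a) (η j) * w₁ η * w₂ η) ψ ≠
        coordAvg μ s (fun η => F (η a) (η j) * w₁ η * w₂ η) ψ' /
          coordAvg μ (insert a s) (fun η => F (η a) (η j) * w₁ η * w₂ η) ψ' := by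
  by_contra hcon
  push Not at hcon
  obtain ⟨φ⟩ := ‹Nonempty (ι → X)›
  exact hF (bond_productForm_of_arConditional_blind μ s has hjs hja F hw₁ hjV₁ hw₂ haV₂ hsV₂ φ
    u u' t t' hw₂ne hG hM fun ψ ψ' h => hcon ψ ψ' h)

/-- **The Gaussian / gradient-`φ⁴` chain bond `exp(−κ(u−t)²/2)` is NOT of product form for `κ ≠ 0`**
(`u ≠ u'`, `t ≠ t'`): the double ratio is `exp(κ(u−u')(t−t')) ≠ 1`.  So, by
`arConditional_reads_bond`, in the chain the exact conditional of a site READS its retained neighbour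
whenever `κ ≠ 0` — C5's "first non-trivial test", the yes direction. [ours] -/
theorem gaussianBond_not_productForm {κ : ℝ} (hκ : κ ≠ 0) {u u' t t' : ℝ} (hu : u ≠ u')
    (ht : t ≠ t') :
    Real.exp (-(κ * (u - t) ^ 2 / 2)) * Real.exp (-(κ * (u' - t') ^ 2 / 2)) ≠
      Real.exp (-(κ * (u - t') ^ 2 / 2)) * Real.exp (-(κ * (u' - t) ^ 2 / 2)) := by
  rw [← Real.exp_add, ← Real.exp_add, Ne, Real.exp_eq_exp]
  intro h
  have : κ * ((u - u') * (t - t')) = 0 := by linarith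
  rcases mul_eq_zero.1 this with h1 | h2
  · exact hκ h1
  · rcases mul_eq_zero.1 h2 with h3 | h4
    · exact hu (sub_eq_zero.1 h3)
    · exact ht (sub_eq_zero.1 h4)

/-! ## §3 (GEN-16, appended) THE CHAIN ASSEMBLED: the open nearest-neighbour chain is faithful -/

section Chain

variable {n : ℕ} [IsProbabilityMeasure μ]

/-- The bond product of the chain splits at the bond `k`: `∏_i b_i = (∏_{i<k} b_i) · b_k · ∏_{k<i} b_i`.
[ours] -/
theorem prod_bond_split (B : Fin (n + 1) → ℝ) (k : Fin (n + 1)) :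
    ∏ i, B i = (∏ i ∈ Finset.univ.filter (· < k), B i) * B k *
      ∏ i ∈ Finset.univ.filter (fun i => k < i), B i := by
  classical
  rw [← Finset.prod_filter_mul_prod_filter_not Finset.univ (· < k)]
  have hset : Finset.univ.filter (fun i : Fin (n + 1) => ¬ i < k) =
      insert k (Finset.univ.filter fun i => k < i) := by
    ext i
    simp only [Finset.mem_filter, Finset.mem_univ, true_and, Finset.mem_insert, not_lt]
    constructor
    · intro h
      rcases eq_or_lt_of_le h with h | h
      · exact Or.inl h.symm
      · exact Or.inr h
    · rintro (rfl | h)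
      · exact le_rfl
      · exact h.le
  rw [hset, Finset.prod_insert (by simp), mul_assoc]

/-- The site product of the chain splits at the site `a`: `∏_i g_i = (∏_{i ≤ a} g_i) · ∏_{a < i} g_i`.
[ours] -/
theorem prod_site_split (Gs : Fin (n + 2) → ℝ) (a : Fin (n + 2)) :
    ∏ i, Gs i = (∏ i ∈ Finset.univ.filter (· ≤ a), Gs i) *
      ∏ i ∈ Finset.univ.filter (fun i => a < i), Gs i := by
  rw [← Finset.prod_filter_mul_prod_filter_not Finset.univ (· ≤ a)]
  congr 2
  ext i
  simp [not_le]

/-- **THE NEAREST-NEIGHBOUR CHAIN IS FAITHFUL: the exact conditional of the site `k` reads the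
retained neighbour `k + 1` whenever their bond factor is not of product form.**  Open chain on
`Fin (n+2)`, positive bounded measurable site and bond factors, any reference probability measure;
`s = {i | i < k}` integrated (generate from the top).  If
`b_k u t · b_k u' t' ≠ b_k u t' · b_k u' t` for some values, there are two configurations agreeing
off `k + 1` on which `A_s w / A_{insert k s} w` differs. [ours] -/
theorem chain_arConditional_reads_neighbour (g : Fin (n + 2) → X → ℝ)
    (b : Fin (n + 1) → X → X → ℝ) (hgm : ∀ i, Measurable (g i))
    (hbm : ∀ i, Measurable (uncurry (b i))) (hgpos : ∀ i v, 0 < g i v)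
    (hbpos : ∀ i v v', 0 < b i v v') (hgbdd : ∀ i, ∃ C, ∀ v, g i v ≤ C)
    (hbbdd : ∀ i, ∃ C, ∀ v v', b i v v' ≤ C) (k : Fin (n + 1)) [Nonempty X] {u u' t t' : X}
    (hF : b k u t * b k u' t' ≠ b k u t' * b k u' t) :
    ∃ ψ ψ' : Fin (n + 2) → X, (∀ i, i ≠ k.succ → ψ i = ψ' i) ∧
      coordAvg μ (Finset.univ.filter (· < k.castSucc))
            (fun φ => (∏ i, g i (φ i)) * ∏ i : Fin (n + 1), b i (φ i.castSucc) (φ i.succ)) ψ /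
          coordAvg μ (insert k.castSucc (Finset.univ.filter (· < k.castSucc)))
            (fun φ => (∏ i, g i (φ i)) * ∏ i : Fin (n + 1), b i (φ i.castSucc) (φ i.succ)) ψ ≠
        coordAvg μ (Finset.univ.filter (· < k.castSucc))
            (fun φ => (∏ i, g i (φ i)) * ∏ i : Fin (n + 1), b i (φ i.castSucc) (φ i.succ)) ψ' /
          coordAvg μ (insert k.castSucc (Finset.univ.filter (· < k.castSucc)))
            (fun φ => (∏ i, g i (φ i)) * ∏ i : Fin (n + 1), b i (φ i.castSucc) (φ i.succ)) ψ' := by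
  classical
  have hlt : k.castSucc < k.succ := Fin.castSucc_lt_succ
  have hltv : (k.castSucc : Fin (n + 2)).val < (k.succ : Fin (n + 2)).val := hlt
  -- the sorting `w = f₀ · w₁ · w₂`
  let w₁ : (Fin (n + 2) → X) → ℝ := fun φ =>
    (∏ i ∈ Finset.univ.filter (· ≤ k.castSucc), g i (φ i)) *
      ∏ i ∈ Finset.univ.filter (· < k), b i (φ i.castSucc) (φ i.succ)
  let w₂ : (Fin (n + 2) → X) → ℝ := fun φ =>
    (∏ i ∈ Finset.univ.filter (fun i => k.castSucc < i), g i (φ i)) *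
      ∏ i ∈ Finset.univ.filter (fun i => k < i), b i (φ i.castSucc) (φ i.succ)
  have hsplit : (fun φ : Fin (n + 2) → X => (∏ i, g i (φ i)) *
      ∏ i : Fin (n + 1), b i (φ i.castSucc) (φ i.succ)) =
      fun φ => b k (φ k.castSucc) (φ k.succ) * w₁ φ * w₂ φ := by
    funext φ
    rw [prod_site_split (fun i => g i (φ i)) k.castSucc,
      prod_bond_split (fun i => b i (φ i.castSucc) (φ i.succ)) k]
    ring
  have haj : k.succ ≠ k.castSucc := hlt.ne'
  have has : k.castSucc ∉ Finset.univ.filter (· < k.castSucc) := by simp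
  have hjs : k.succ ∉ Finset.univ.filter (· < k.castSucc) := by
    simp only [Finset.mem_filter, Finset.mem_univ, true_and, not_lt]
    exact hlt.le
  -- what `w₁`, `w₂` read
  have hw₁ : DependsOn w₁ {i | i ≤ k.castSucc} := by
    intro φ φ' h
    simp only [w₁]
    congr 1
    · exact Finset.prod_congr rfl fun i hi => by rw [h i (by simpa using hi)]
    · refine Finset.prod_congr rfl fun i hi => ?_
      have hik : i < k := by simpa using hi
      have hikv : i.val < k.val := hik
      have h1 : i.castSucc ≤ k.castSucc := by
        rw [Fin.le_def]; simp only [Fin.val_castSucc]; omega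
      have h2 : i.succ ≤ k.castSucc := by
        rw [Fin.le_def]; simp only [Fin.val_succ, Fin.val_castSucc]; omega
      rw [h i.castSucc h1, h i.succ h2]
  have hjV₁ : k.succ ∉ {i : Fin (n + 2) | i ≤ k.castSucc} := by
    simp only [Set.mem_setOf_eq, not_le]; exact hlt
  have hw₂ : DependsOn w₂ {i | k.castSucc < i} := by
    intro φ φ' h
    simp only [w₂]
    congr 1
    · exact Finset.prod_congr rfl fun i hi => by rw [h i (by simpa using hi)]
    · refine Finset.prod_congr rfl fun i hi => ?_
      have hik : k < i := by simpa using hi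
      have hikv : k.val < i.val := hik
      have h1 : k.castSucc < i.castSucc := by
        rw [Fin.lt_def]; simp only [Fin.val_castSucc]; omega
      have h2 : k.castSucc < i.succ := by
        rw [Fin.lt_def]; simp only [Fin.val_succ, Fin.val_castSucc]; omega
      rw [h i.castSucc h1, h i.succ h2]
  have haV₂ : k.castSucc ∉ {i : Fin (n + 2) | k.castSucc < i} := by simp
  have hsV₂ : ∀ i ∈ Finset.univ.filter (· < k.castSucc), i ∉ {i : Fin (n + 2) | k.castSucc < i} := by
    intro i hi
    simp only [Finset.mem_filter, Finset.mem_univ, true_and] at hi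
    simp only [Set.mem_setOf_eq, not_lt]
    exact hi.le
  -- non-vanishing: everything is positive; the averages by integrability (bounded measurable)
  have hw₁pos : ∀ φ, 0 < w₁ φ := fun φ =>
    mul_pos (Finset.prod_pos fun i _ => hgpos i _) (Finset.prod_pos fun i _ => hbpos i _ _)
  have hw₂pos : ∀ φ, 0 < w₂ φ := fun φ =>
    mul_pos (Finset.prod_pos fun i _ => hgpos i _) (Finset.prod_pos fun i _ => hbpos i _ _)
  have hgm' : ∀ i, Measurable fun φ : Fin (n + 2) → X => g i (φ i) :=
    fun i => (hgm i).comp (measurable_pi_apply i)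
  have hbm' : ∀ i : Fin (n + 1),
      Measurable fun φ : Fin (n + 2) → X => b i (φ i.castSucc) (φ i.succ) := fun i =>
    show Measurable (uncurry (b i) ∘ fun φ : Fin (n + 2) → X => (φ i.castSucc, φ i.succ)) from
      (hbm i).comp ((measurable_pi_apply _).prodMk (measurable_pi_apply _))
  have hw₁m : Measurable w₁ :=
    (Finset.measurable_prod _ fun i _ => hgm' i).mul (Finset.measurable_prod _ fun i _ => hbm' i)
  choose Cg hCg using hgbdd
  choose Cb hCb using hbbdd
  have hw₁bdd : ∀ φ, w₁ φ ≤ (∏ i ∈ Finset.univ.filter (· ≤ k.castSucc), Cg i) *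
      ∏ i ∈ Finset.univ.filter (· < k), Cb i := fun φ =>
    mul_le_mul (Finset.prod_le_prod (fun i _ => (hgpos i _).le) fun i _ => hCg i _)
      (Finset.prod_le_prod (fun i _ => (hbpos i _ _).le) fun i _ => hCb i _ _)
      (Finset.prod_nonneg fun i _ => (hbpos i _ _).le)
      (Finset.prod_nonneg fun i _ => le_trans (hgpos i (φ i)).le (hCg i _))
  have hint : ∀ (t : Finset (Fin (n + 2))) (φ : Fin (n + 2) → X) {W : (Fin (n + 2) → X) → ℝ},
      Measurable W → (∀ η, 0 < W η) → (∃ C, ∀ η, W η ≤ C) →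
        Integrable (fun η : Fin (n + 2) → X => W (t.piecewise η φ)) (Measure.pi fun _ => μ) := by
    intro t φ W hWm hWpos hWC
    obtain ⟨C, hC⟩ := hWC
    refine Integrable.mono' (integrable_const C)
      ((hWm.comp (measurable_piecewise_left t φ)).aestronglyMeasurable) (ae_of_all _ fun η => ?_)
    rw [Real.norm_eq_abs, abs_of_pos (hWpos _)]
    exact hC _
  have hG : ∀ ψ, coordAvg μ (Finset.univ.filter (· < k.castSucc)) w₁ ψ ≠ 0 := fun ψ =>
    (coordAvg_pos_of_pos μ _ hw₁pos ψ (hint _ ψ hw₁m hw₁pos ⟨_, hw₁bdd⟩)).ne'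
  -- the full weight is positive bounded measurable too
  have hwm : Measurable fun η : Fin (n + 2) → X =>
      b k (η k.castSucc) (η k.succ) * w₁ η * w₂ η := by
    rw [← hsplit]
    exact (Finset.measurable_prod _ fun i _ => hgm' i).mul
      (Finset.measurable_prod _ fun i _ => hbm' i)
  have hwpos : ∀ η : Fin (n + 2) → X, 0 < b k (η k.castSucc) (η k.succ) * w₁ η * w₂ η := fun η =>
    mul_pos (mul_pos (hbpos k _ _) (hw₁pos η)) (hw₂pos η)
  have hwbdd : ∃ C, ∀ η : Fin (n + 2) → X, b k (η k.castSucc) (η k.succ) * w₁ η * w₂ η ≤ C := by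
    refine ⟨(∏ i, Cg i) * ∏ i, Cb i, fun η => ?_⟩
    have hη := congrFun hsplit η
    rw [← hη]
    exact mul_le_mul (Finset.prod_le_prod (fun i _ => (hgpos i _).le) fun i _ => hCg i _)
      (Finset.prod_le_prod (fun i _ => (hbpos i _ _).le) fun i _ => hCb i _ _)
      (Finset.prod_nonneg fun i _ => (hbpos i _ _).le)
      (Finset.prod_nonneg fun i _ => le_trans (hgpos i (η i)).le (hCg i _))
  have hM : ∀ ψ, coordAvg μ (insert k.castSucc (Finset.univ.filter (· < k.castSucc)))
      (fun η => b k (η k.castSucc) (η k.succ) * w₁ η * w₂ η) ψ ≠ 0 := fun ψ =>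
    (coordAvg_pos_of_pos μ _ hwpos ψ (hint _ ψ hwm hwpos hwbdd)).ne'
  rw [hsplit]
  exact arConditional_reads_bond μ (Finset.univ.filter (· < k.castSucc)) has hjs haj (b k) hw₁ hjV₁
    hw₂ haV₂ hsV₂ (fun ψ => (hw₂pos ψ).ne') hG hM hF

/-- **The Gaussian / gradient-`φ⁴` chain** (`X = ℝ`, bond `e^{−κ(u−t)²/2}` at position `k` with
`κ > 0`, arbitrary positive bounded measurable site factors and other bonds, any reference probability
measure on `ℝ`): the exact conditional of the site `k` given the higher sites READS the neighbour
`k + 1` — C5's "first non-trivial test", yes direction, as a theorem. [ours] -/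
theorem gaussianChain_arConditional_reads_neighbour (μ : Measure ℝ) [IsProbabilityMeasure μ]
    (g : Fin (n + 2) → ℝ → ℝ) (b : Fin (n + 1) → ℝ → ℝ → ℝ) (hgm : ∀ i, Measurable (g i))
    (hbm : ∀ i, Measurable (uncurry (b i))) (hgpos : ∀ i v, 0 < g i v)
    (hbpos : ∀ i v v', 0 < b i v v') (hgbdd : ∀ i, ∃ C, ∀ v, g i v ≤ C)
    (hbbdd : ∀ i, ∃ C, ∀ v v', b i v v' ≤ C) (k : Fin (n + 1)) {κ : ℝ} (hκ : 0 < κ)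
    (hbk : ∀ v v', b k v v' = Real.exp (-(κ * (v - v') ^ 2 / 2))) :
    ∃ ψ ψ' : Fin (n + 2) → ℝ, (∀ i, i ≠ k.succ → ψ i = ψ' i) ∧
      coordAvg μ (Finset.univ.filter (· < k.castSucc))
            (fun φ => (∏ i, g i (φ i)) * ∏ i : Fin (n + 1), b i (φ i.castSucc) (φ i.succ)) ψ /
          coordAvg μ (insert k.castSucc (Finset.univ.filter (· < k.castSucc)))
            (fun φ => (∏ i, g i (φ i)) * ∏ i : Fin (n + 1), b i (φ i.castSucc) (φ i.succ)) ψ ≠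
        coordAvg μ (Finset.univ.filter (· < k.castSucc))
            (fun φ => (∏ i, g i (φ i)) * ∏ i : Fin (n + 1), b i (φ i.castSucc) (φ i.succ)) ψ' /
          coordAvg μ (insert k.castSucc (Finset.univ.filter (· < k.castSucc)))
            (fun φ => (∏ i, g i (φ i)) * ∏ i : Fin (n + 1), b i (φ i.castSucc) (φ i.succ)) ψ' := by
  refine chain_arConditional_reads_neighbour μ g b hgm hbm hgpos hbpos hgbdd hbbdd k
    (u := 0) (u' := 1) (t := 0) (t' := 1) ?_
  rw [hbk, hbk, hbk, hbk]
  exact gaussianBond_not_productForm hκ.ne' zero_ne_one zero_ne_one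

end Chain

end Summit.Ventures.LatticeQCDFlow.Theory2.Autoregressive

end
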